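import Summits.BirchSwinnertonDyer.Rank1Residual.P2.CongruentNumberSilentEvenFiveProofBHook
import Literature.NumberTheory.QuadraticFields.RedeiReichardtFourRank
import Mathlib.Tactic.NormNum.LegendreSymbol
import HarnessLib

/-!
# REVIEW-RUNBOOK sanity lemma — the silent-even-five congruent-number family is inhabited
# WITH an odd genus class number (client `bsd-monsky` of the ops review-runbook generator)

Card (2)(b) («non-vacuity») of `run/shared/lean/bsd/bsd-monsky/REVIEW-RUNBOOK.md`: the statements
`P2.theoremB_of_thetaGenusPointDatum` and
`P2.forall_bsdp_two_congruentNumberCurve_two_mul_five_mul_of_theoremB` quantify over primes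
`p ≡ 5 (mod 8)`, `q ≡ 3 (mod 4)`, the first under the further hypothesis that the genus class number
`g(2pq)` of `ℚ(√−2pq)` is ODD.  This file records, as ONE closed theorem of the shape the
generator's probe matches (`∃ p q, h₁ ∧ … ∧ h₅`), that all five hypotheses hold together at the
smallest member of the family, `(p, q) = (5, 3)` (`n = 2pq = 30`): `(5/3) = (2/3) = −1`, so Rédei's
matrix has four-rank `0` and `g(30)` is odd — the tree's
`P2.odd_genusClassNumber_genusField_two_mul_five_mul_of_jacobiSym_neg` (mod Rédei–Reichardt, which
is PROVED in the tree: `RedeiReichardt.redeiReichardt_fourTwoCard_classGroup_holds`).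

Review evidence only; nothing here is used by a theorem of the tree; no definitions, no `sorry`,
standard axioms.
-/

namespace Summit.BirchSwinnertonDyer.Rank1Residual.Runbook

open Literature.NumberTheory.EllipticCurves Literature.NumberTheory.EllipticCurves.TianYuanZhang2017
open Literature.NumberTheory.QuadraticFields.RedeiReichardt (redeiReichardt_fourTwoCard_classGroup_holds)

/-- `(5/3) = −1` (the Jacobi symbol: `5 ≡ 2 (mod 3)` is a non-residue). [folklore] -/
theorem jacobiSym_five_three : jacobiSym 5 3 = -1 := by norm_num

/-- (b) **The five hypotheses of `P2.theoremB_of_thetaGenusPointDatum` (and the four of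
`P2.forall_bsdp_two_congruentNumberCurve_two_mul_five_mul_of_theoremB`) hold together** at
`(p, q) = (5, 3)`: `5` and `3` are prime, `5 % 8 = 5`, `3 % 4 = 3`, and the genus class number of
`GenusField (2·(5·3)) = ℚ(√−30)` is odd (Rédei: `(5/3) = −1`;
`P2.odd_genusClassNumber_genusField_two_mul_five_mul_of_jacobiSym_neg` with Rédei–Reichardt
discharged by `redeiReichardt_fourTwoCard_classGroup_holds`).  So the silent-even-five family the two
statements range over is inhabited at its first member `n = 30`. [folklore] -/
theorem thetaGenus_hypotheses :
    ∃ p q : ℕ, Nat.Prime p ∧ Nat.Prime q ∧ p % 8 = 5 ∧ q % 4 = 3 ∧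
      Odd (genusClassNumber (GenusField (2 * (p * q)))) :=
  ⟨5, 3, by norm_num, by norm_num, rfl, rfl,
    P2.odd_genusClassNumber_genusField_two_mul_five_mul_of_jacobiSym_neg
      redeiReichardt_fourTwoCard_classGroup_holds (by norm_num) (by norm_num) rfl rfl
      jacobiSym_five_three⟩

end Summit.BirchSwinnertonDyer.Rank1Residual.Runbook
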